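import Summits.BirchSwinnertonDyer.BirchSwinnertonDyer.Theorems.ClassRecordThreeEulerHalvesAtThreeJetchevNotRam
import Summits.BirchSwinnertonDyer.Rank1Residual.X11b.Three.CyclotomicNonsplitUpper

/-!
# Route `ClassRecordThree` (rung K2@3), crux 5 `EulerHalvesAtThree` (item 19109), file 3: the ¬(ram) ∧ surj
# clause SPLIT BY REDUCTION TYPE AT 3 — non-split from Schneider at the pair (road (a) WITHOUT (ram), Kato's
# divisibility instead of Skinner's equality), split from J₃⁰ + TL₃ (cell `bsd-stepL`, seat
# `bsd-stepL-tam3-p1`; `--supports stmt-BirchSwinnertonDyer-19109 --as helper`)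

Files 1–2 (`ClassRecordThreeEulerHalvesAtThreeJetchev{,NotRam}.lean`) reduce the crux to J₃ʳ ∧ J₃⁰ ∧ TL₃.
On the NON-SPLIT part of the ¬(ram) ∧ surj locus there is a SECOND supplier already in the tree, needing
neither a (ram) prime nor `3 ∤ ∏c`: x11b3's `missingUpperBoundAt_of_classX11b_of_nonsplit_of_surjPow_of_schneider`
(`X11b/Three/CyclotomicNonsplitUpper.lean`) — Kato's divisibility `g ∈ char_Λ X(E/ℚ_∞)`,
`ι g = ϖ·L_3(E,T)` for `ρ_{E,3^∞}` onto (Wuthrich 2014 Thm. 3 / Cor. 19 = Stein–Wuthrich Thm. 7.3, named fact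
`kato_charIdeal_dvd_multiplicative_of_surjective`), Stein–Wuthrich Thm. 6.1, Disegni 2020 Thm. 1 (non-split)
and Schneider's non-degeneracy AT THE PAIR give `ord₃ #Ш(E) ≤ ord₃ #Ш(E)_an`. So:

* §5 `missingUpperBoundAt_three_of_classX11b_of_not_split_of_surj_of_regulatorNonvanishing` — on X11b@3 ∧
  non-split ∧ surj (ram OR not, any Tamagawa numbers): the upper half from the published facts and
  `ClassClosure.RegulatorNonvanishingAt W 3` — the predicate of crux 19106 `SchneiderAtThree` (there asked
  only on (ram) ∧ non-split), here consumed on ¬(ram) ∧ non-split. `3`-adic tower surjectivity from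
  `Surj W 3` at the multiplicative `3` by the Tate line (tree theorem), so no `lemma20` fact is needed.
* §6 `missingUpperBoundAt_three_of_classX11b_of_split_of_surj_of_not_ram_of_jetchevDivisibility_of_twistLower`
  — file 2's §3 with the Jetchev binder restricted to SPLIT-at-`3` frames (**J₃⁰ˢ**; the cyclotomic road
  has an exceptional zero at a split `3` and Disegni's (∗) reads `p ≥ 5`, so on ¬(ram) ∧ split the
  Heegner-point road is the only one in sight).
* §7 `classRecordThree_eulerHalvesAtThree_of_jetchevDivisibility_of_schneider_of_twistLower` — the crux BY
  NAME from the published facts and the open inputs {J₃ʳ, J₃⁰ˢ, TL₃, Schneider on ¬(ram) ∧ non-split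
  (`hRegNR`)}: an ALTERNATIVE menu to file 2's {J₃ʳ, J₃⁰, TL₃} in which the non-split third of clause (0)
  is moved from the Heegner road to the route's own road (a). Which menu the route files is the planner's call.

HONEST FRAMING. Hypothesis-shaped binders only; the item does NOT close; nothing booked; CONDITIONAL on every
binder (in particular on the flagged readings behind `kato_charIdeal_dvd_multiplicative_of_surjective` at `3`).

References: [Wuthrich2014] Thm. 3, Cor. 19, Lemma 20; [SteinWuthrich2013] Thm. 6.1, Thm. 7.3, §4.2;
[Disegni2020] Thm. 1, Thm. 4; [Schneider1982PadicHeightI] §1; files 1–2 and `X11b/Three/CyclotomicNonsplitUpper.lean`.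
-/

noncomputable section

open scoped Classical

namespace Summit.BirchSwinnertonDyer.Rank1Residual.X11b.Three.Koly

open WeierstrassCurve Literature.NumberTheory.EllipticCurves
  Literature.NumberTheory.EllipticCurves.ModularForms
  Literature.NumberTheory.EllipticCurves.Rank1Residual
  Literature.NumberTheory.EllipticCurves.Rank1Residual.X11RankOneCertificates
  Literature.NumberTheory.EllipticCurves.Wuthrich2014
  Literature.NumberTheory.EllipticCurves.SteinWuthrich2013
  Literature.NumberTheory.EllipticCurves.Disegni2020
  Summit.BirchSwinnertonDyer.Rank1Residual Summit.BirchSwinnertonDyer.Rank1Residual.X11b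

/-! ### §5 ¬split ∧ surj (ram or not): the upper half from Schneider at the pair (road (a), Kato form) -/

/-- **X11b@3 ∧ NON-SPLIT ∧ `ρ̄_{E,3}` onto — with or without a (ram) witness, any Tamagawa numbers: the
Euler-system half from Schneider's non-degeneracy at the pair.** Inputs: Kato's divisibility for
surjective `ρ_{E,3^∞}` (`hK`), Stein–Wuthrich Thm. 6.1 (`hJn`), Disegni 2020 Thm. 1 non-split (`hDn`), the
canonical `3`-adic height datum (`hHn`), the Mazur–Tate–Teitelbaum function at `a₃ = −1` (`hLns`), GZK
(`hGZK`), modular parametrisations (`hpar`) — all named facts of the tree —, and the per-pair predicate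
`ClassClosure.RegulatorNonvanishingAt W 3` (crux 19106's statement; its non-split clause is used). Proof:
`3`-adic tower surjectivity from `Surj W 3` at the multiplicative `3` (Tate line, tree theorem), then x11b3's
`missingUpperBoundAt_of_classX11b_of_nonsplit_of_surjPow_of_schneider`. CONDITIONAL; nothing booked.
[cite: Wuthrich2014, Thm. 3 (p. 382) and Cor. 19 (p. 398)] [cite: SteinWuthrich2013, Thm. 6.1 (p. 20), Thm. 7.3, §4.2]
[cite: Disegni2020, Thm. 1 and Thm. 4] [cite: Schneider1982PadicHeightI, §1] [cite: Miller2011LMS, Def. 1.1] -/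
theorem missingUpperBoundAt_three_of_classX11b_of_not_split_of_surj_of_regulatorNonvanishing
    (hK : kato_charIdeal_dvd_multiplicative_of_surjective) (hJn : thm61_nonsplitMultiplicative)
    (hDn : thm1_padicBSD_nonsplitMultiplicative) (hHn : exists_isMultCanonical)
    (hLns : exists_isMultPAdicLFunctionOf_neg_one)
    (hGZK : rank_eq_analyticRank_of_analyticRank_le_one)
    (hpar : nonempty_modularParametrizationData)
    (W : WeierstrassCurve ℚ) [W.IsElliptic] [W.IsGloballyMinimal] (hX : ClassX11b W 3)
    (hns : ¬ W.HasSplitMultiplicativeReductionAtPrime 3) (hρ : Surj W 3)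
    (hReg : ClassClosure.RegulatorNonvanishingAt W 3) : Typed.MissingUpperBoundAt W 3 := by
  haveI : Fact (Nat.Prime 3) := ⟨Nat.prime_three⟩
  have hsurj : ∀ m : ℕ, W.HasSurjectiveModNGaloisRep (3 ^ m : ℕ) :=
    Rank1Residual.surjective_pow_three_of_mult_of_tateLine W hX.2.2.1 hρ
  exact missingUpperBoundAt_of_classX11b_of_nonsplit_of_surjPow_of_schneider hK hJn hDn hHn hLns hGZK
    hpar W 3 hX hns hsurj (fun q hq0 hq1 hqj Dh hDh ↦ hReg.1 q Dh hq0 hq1 hqj hDh)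

/-! ### §6 split ∧ surj ∧ ¬(ram): file 2's §3 with the Jetchev binder asked on SPLIT frames only (J₃⁰ˢ) -/

/-- **X11b@3 ∧ SPLIT ∧ surj ∧ ¬(ram): the Euler-system half from the Jetchev direction on split ¬(ram)
frames (J₃⁰ˢ) and the twist's rank-`0` lower bound TL₃.** Verbatim file 2's
`missingUpperBoundAt_three_of_classX11b_of_surj_of_not_ram_of_jetchevDivisibility_of_twistLower` with the
extra hypothesis "split multiplicative at `3`" threaded into the binder `hJ0` (so the open input is asked
on fewer curves) and into the theorem. CONDITIONAL on every binder; nothing booked.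
[cite: McCallumLMS1991, §5 Cor. 5.6 (p. 310)] [cite: Jetchev2008, Conj. 1.3 (p. 812)]
[cite: Skinner2016PacificMC, Thm. C (§1) — shape of TL₃ only] [cite: Darmon2004, Thm. 3.6 (PDF p. 43)]
[cite: Miller2011LMS, Def. 1.1] -/
theorem missingUpperBoundAt_three_of_classX11b_of_split_of_surj_of_not_ram_of_jetchevDivisibility_of_twistLower
    -- published named facts
    (hGZ : ∀ (N : ℕ) [NeZero N] (W : WeierstrassCurve ℚ) (K : Type) [Field K] [NumberField K],
      gross_zagier N W K)
    (hKo : ∀ (N : ℕ) [NeZero N] (W : WeierstrassCurve ℚ) (K : Type) [Field K] [NumberField K],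
      kolyvagin N W K)
    (hGZK : rank_eq_analyticRank_of_analyticRank_le_one) (hmod : hasEntireLFunction_rat)
    (hnf : exists_isNewformOf) (hHL : HoffsteinLuo1997_exists_twist_L_one_ne_zero)
    (hMaz : mazur_not_dvd_maninConstant_of_odd)
    (hrec : ∀ (N : ℕ) [NeZero N] (W : WeierstrassCurve ℚ) (K : Type) [Field K] [NumberField K],
      heegnerPointOfConductor_one_galoisConj N W K)
    (hD36 : ∀ (N : ℕ) [NeZero N] (W : WeierstrassCurve ℚ) (K : Type) [Field K] [NumberField K],
      phi_heegnerTau_mem_singularModuliField N W K)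
    (hMcU : McCallum1991_padicValNat_card_sha_primary_add_le_of_globalDivisibility)
    -- OPEN INPUT J₃⁰ˢ: the Jetchev direction at 3 ∥ N on SPLIT ∧ ¬(ram) ∧ surj frames
    (hJ0 : ∀ (W : WeierstrassCurve ℚ) [W.IsElliptic] [W.IsGloballyMinimal] [NeZero (W.conductorNorm ℤ)]
      (K : Type) [Field K] [NumberField K]
      (Dt : ModularParametrizationData W (W.conductorNorm ℤ)) (β : ℤ) (ι : K →+* ℂ),
      W.HasSplitMultiplicativeReductionAtPrime 3 → Surj W 3 → ¬ Ram W 3 →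
      IsImaginaryQuadratic K → SatisfiesHeegnerHypothesis (W.conductorNorm ℤ) K →
      NumberField.discr K ≠ -3 →
      (4 * (W.conductorNorm ℤ : ℤ)) ∣ β ^ 2 - NumberField.discr K → ¬ (3 : ℤ) ∣ Dt.c →
      ∀ (s : ℕ), s ≤ padicValNat 3 W.tamagawaProduct →
        ∀ (n : ℕ) (d : KolyvaginHeegnerData Dt β ι n), Squarefree n →
          (∀ ℓ ∈ n.primeFactors, Zhang2014.IsKolyvaginPrime (W.conductorNorm ℤ) W K 3 ℓ ∧
            s ≤ Zhang2014.kolyvaginIndex W 3 ℓ) → PDiv d 3 s)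
    -- OPEN INPUT TL₃ (as in file 2)
    (hTL : ∀ (V : WeierstrassCurve ℚ) [V.IsElliptic] [V.IsGloballyMinimal],
      V.HasMultiplicativeReductionAtPrime 3 → V.HasIrreducibleModPGaloisRep 3 →
      V.entireLFunction 1 ≠ 0 → Finite V.sha →
      ∃ q : ℚ, V.entireLFunction 1 / (V.realPeriodRat : ℂ) = (q : ℂ) ∧
        padicValRat 3 q ≤ (padicValNat 3 V.shaOrder : ℤ) + padicValNat 3 V.tamagawaProduct -
          2 * padicValNat 3 V.torsionOrder)
    -- the pair
    (W : WeierstrassCurve ℚ) [W.IsElliptic] [W.IsGloballyMinimal]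
    (hX : ClassX11b W 3) (hsplit : W.HasSplitMultiplicativeReductionAtPrime 3) (hρ : Surj W 3)
    (hnram : ¬ Ram W 3) : Typed.MissingUpperBoundAt W 3 := by
  haveI : NeZero (W.conductorNorm ℤ) := ⟨(W.conductorNorm_pos_holds).ne'⟩
  obtain ⟨hr, h32, hmult, hirr⟩ := hX
  obtain ⟨K, _, _, Dt, H, ι, P, Wd, _, _, Cd, hK, hodd, h3d, hHN, hP, hc, hμ, hLt, hWd⟩ :=
    exists_oddHeegnerData hnf hHL hMaz integral_neronScaling_of_isGloballyMinimal_holds W 3 hr h32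
      hmult hirr
  have h3 : NumberField.discr K ≠ -3 := by
    intro h
    exact h3d (h ▸ ⟨-1, by norm_num⟩)
  have h4 : NumberField.discr K ≠ -4 := by
    intro h
    rw [h] at hodd
    exact (Int.not_odd_iff_even.mpr ⟨-2, by norm_num⟩) hodd
  obtain ⟨d₁⟩ := exists_kolyvaginHeegnerData_one (hD36 _ W K) hK Dt H.β ι H.dvd_sq_sub
  have hPd : d₁.toGeomPoints d₁.derivedPoint = toGeomPoints (W.baseChange K) P :=
    KolyvaginBottom.toGeomPoints_derivedPoint_one_eq (hrec _ W K) hK hHN hP d₁ rfl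
  have hU : Finite (W.baseChange K).sha → ¬ IsOfFinAddOrder P →
      padicValNat 3 (Nat.card (W.baseChange K).sha) + 2 * padicValNat 3 W.tamagawaProduct ≤
        2 * padicValNat 3 (AddSubgroup.zmultiples P).index := by
    intro hfin hPinf
    haveI : Finite (W.baseChange K).sha := hfin
    obtain ⟨hrank, -⟩ := hKo (W.conductorNorm ℤ) W K hK hHN ⟨Dt, H, ι, hP⟩ hPinf
    have hbot := torsionBy_eq_bot_of_isImaginaryQuadratic_of_hasIrreducibleModPGaloisRep W K hK
      Nat.prime_three hirr
    have hiv : ∀ x : (W.baseChange K).toAffine.Point, 3 • x = 0 → x = 0 := fun x hx ↦ by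
      have hmem : x ∈ AddSubgroup.torsionBy (W.baseChange K).toAffine.Point ((3 : ℕ) : ℤ) := by
        rw [mem_torsionBy_iff, natCast_zsmul]
        exact hx
      rw [hbot] at hmem
      exact hmem
    exact shaIndexBound_sharp_three_of_globalDivisibility hMcU W K hmult hρ hK h3 h4 hHN Dt H.β ι d₁ P
      hPd hPinf hrank hiv (hJ0 W K Dt H.β ι hsplit hρ hnram hK hHN h3 H.dvd_sq_sub hc)
  have hD0 : (NumberField.discr K : ℚ) ≠ 0 := by exact_mod_cast NumberField.discr_ne_zero K
  haveI hEt : (W.quadraticTwist (NumberField.discr K : ℚ)).IsElliptic :=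
    W.isElliptic_quadraticTwist hD0
  have hmultd : Wd.HasMultiplicativeReductionAtPrime 3 :=
    hasMultiplicativeReductionAtPrime_twist_of_heegner' W 3 K hK hHN hmult Cd hWd
  have hirrd : Wd.HasIrreducibleModPGaloisRep 3 :=
    hasIrreducibleModPGaloisRep_twist_model W 3 K hK.1 hirr Cd hWd
  have htam : padicValNat 3 Wd.tamagawaProduct = padicValNat 3 W.tamagawaProduct :=
    X2.padicValNat_tamagawaProduct_twist_of_heegner_of_odd W 3 h32 K hK hodd h3d hHN Cd hWd
  have hu : padicValRat 3 (Cd.u : ℚ) = 0 :=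
    padicValRat_u_eq_zero_of_twist_minimal W 3 K hK hHN hmult Cd hWd
  have hLt' : (W.quadraticTwist (NumberField.discr K : ℚ)).entireLFunction = Wd.entireLFunction := by
    rw [← hWd, entireLFunction_smul]
  have hLd1 : Wd.entireLFunction 1 ≠ 0 := by rw [← hLt']; exact hLt
  have hfinSd : Finite Wd.sha := (hGZK Wd (by
    rw [(Wd.analyticRank_eq_zero_iff_holds (hmod Wd)).2 hLd1]; omega)).2
  obtain ⟨qd, hqd, hvqd⟩ := hTL Wd hmultd hirrd hLd1 hfinSd
  exact missingUpperBoundAt_of_shaIndexBound_sharp W 3 (W.conductorNorm ℤ) K Dt H ι P (hGZ _ W K)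
    (hKo _ W K) hGZK hmod hK hHN hP h32 hc hμ hr hLt Wd Cd hWd hu htam le_rfl ⟨qd, hqd, hvqd⟩ hU

/-! ### §7 The crux BY NAME from {J₃ʳ, J₃⁰ˢ, TL₃, Schneider on ¬(ram) ∧ non-split} -/

/-- **Item 19109 `EulerHalvesAtThree` from the published named facts and the open inputs J₃ʳ, J₃⁰ˢ,
TL₃ and Schneider's non-degeneracy on the ¬(ram) ∧ non-split ∧ surj pairs (`hRegNR`, the predicate of
crux 19106 asked off (ram)).** Clause (α)/(γ): file 1 §2; clause (0) ¬(ram) ∧ surj: non-split by §5,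
split by §6. CONDITIONAL on every binder; the item does NOT close by this theorem; nothing booked.
[cite: McCallumLMS1991, §5 Cor. 5.6 (p. 310)] [cite: Jetchev2008, Conj. 1.3 (p. 812)]
[cite: Wuthrich2014, Thm. 3 (p. 382)] [cite: Schneider1982PadicHeightI, §1] -/
theorem classRecordThree_eulerHalvesAtThree_of_jetchevDivisibility_of_schneider_of_twistLower
    (hGZ : ∀ (N : ℕ) [NeZero N] (W : WeierstrassCurve ℚ) (K : Type) [Field K] [NumberField K],
      gross_zagier N W K)
    (hKo : ∀ (N : ℕ) [NeZero N] (W : WeierstrassCurve ℚ) (K : Type) [Field K] [NumberField K],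
      kolyvagin N W K)
    (hSk : Skinner2016.thmC_padicValRat_bsd_rank_zero)
    (hGZK : rank_eq_analyticRank_of_analyticRank_le_one) (hmod : hasEntireLFunction_rat)
    (hnf : exists_isNewformOf) (hHL : HoffsteinLuo1997_exists_twist_L_one_ne_zero)
    (hMaz : mazur_not_dvd_maninConstant_of_odd)
    (hrec : ∀ (N : ℕ) [NeZero N] (W : WeierstrassCurve ℚ) (K : Type) [Field K] [NumberField K],
      heegnerPointOfConductor_one_galoisConj N W K)
    (hD36 : ∀ (N : ℕ) [NeZero N] (W : WeierstrassCurve ℚ) (K : Type) [Field K] [NumberField K],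
      phi_heegnerTau_mem_singularModuliField N W K)
    (hMcU : McCallum1991_padicValNat_card_sha_primary_add_le_of_globalDivisibility)
    (hK : kato_charIdeal_dvd_multiplicative_of_surjective) (hJn : thm61_nonsplitMultiplicative)
    (hDn : thm1_padicBSD_nonsplitMultiplicative) (hHn : exists_isMultCanonical)
    (hLns : exists_isMultPAdicLFunctionOf_neg_one) (hpar : nonempty_modularParametrizationData)
    -- OPEN INPUT J₃ʳ (file 1)
    (hJ : ∀ (W : WeierstrassCurve ℚ) [W.IsElliptic] [W.IsGloballyMinimal] [NeZero (W.conductorNorm ℤ)]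
      (K : Type) [Field K] [NumberField K]
      (Dt : ModularParametrizationData W (W.conductorNorm ℤ)) (β : ℤ) (ι : K →+* ℂ),
      W.HasMultiplicativeReductionAtPrime 3 → Surj W 3 → Ram W 3 →
      IsImaginaryQuadratic K → SatisfiesHeegnerHypothesis (W.conductorNorm ℤ) K →
      NumberField.discr K ≠ -3 →
      (4 * (W.conductorNorm ℤ : ℤ)) ∣ β ^ 2 - NumberField.discr K → ¬ (3 : ℤ) ∣ Dt.c →
      ∀ (s : ℕ), s ≤ padicValNat 3 W.tamagawaProduct →
        ∀ (n : ℕ) (d : KolyvaginHeegnerData Dt β ι n), Squarefree n →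
          (∀ ℓ ∈ n.primeFactors, Zhang2014.IsKolyvaginPrime (W.conductorNorm ℤ) W K 3 ℓ ∧
            s ≤ Zhang2014.kolyvaginIndex W 3 ℓ) → PDiv d 3 s)
    -- OPEN INPUT J₃⁰ˢ (§6)
    (hJ0 : ∀ (W : WeierstrassCurve ℚ) [W.IsElliptic] [W.IsGloballyMinimal] [NeZero (W.conductorNorm ℤ)]
      (K : Type) [Field K] [NumberField K]
      (Dt : ModularParametrizationData W (W.conductorNorm ℤ)) (β : ℤ) (ι : K →+* ℂ),
      W.HasSplitMultiplicativeReductionAtPrime 3 → Surj W 3 → ¬ Ram W 3 →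
      IsImaginaryQuadratic K → SatisfiesHeegnerHypothesis (W.conductorNorm ℤ) K →
      NumberField.discr K ≠ -3 →
      (4 * (W.conductorNorm ℤ : ℤ)) ∣ β ^ 2 - NumberField.discr K → ¬ (3 : ℤ) ∣ Dt.c →
      ∀ (s : ℕ), s ≤ padicValNat 3 W.tamagawaProduct →
        ∀ (n : ℕ) (d : KolyvaginHeegnerData Dt β ι n), Squarefree n →
          (∀ ℓ ∈ n.primeFactors, Zhang2014.IsKolyvaginPrime (W.conductorNorm ℤ) W K 3 ℓ ∧
            s ≤ Zhang2014.kolyvaginIndex W 3 ℓ) → PDiv d 3 s)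
    -- OPEN INPUT TL₃ (file 2)
    (hTL : ∀ (V : WeierstrassCurve ℚ) [V.IsElliptic] [V.IsGloballyMinimal],
      V.HasMultiplicativeReductionAtPrime 3 → V.HasIrreducibleModPGaloisRep 3 →
      V.entireLFunction 1 ≠ 0 → Finite V.sha →
      ∃ q : ℚ, V.entireLFunction 1 / (V.realPeriodRat : ℂ) = (q : ℂ) ∧
        padicValRat 3 q ≤ (padicValNat 3 V.shaOrder : ℤ) + padicValNat 3 V.tamagawaProduct -
          2 * padicValNat 3 V.torsionOrder)
    -- OPEN INPUT: Schneider's non-degeneracy on ¬(ram) ∧ non-split ∧ surj X11b@3 pairs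
    (hRegNR : ∀ (W : WeierstrassCurve ℚ) [W.IsElliptic] [W.IsGloballyMinimal],
      ClassX11b W 3 → ¬ Ram W 3 → Surj W 3 → ¬ W.HasSplitMultiplicativeReductionAtPrime 3 →
        ClassClosure.RegulatorNonvanishingAt W 3) :
    Summit.BirchSwinnertonDyer.BirchSwinnertonDyer.Theses.ClassRecordThree.EulerHalvesAtThree := by
  unfold Summit.BirchSwinnertonDyer.BirchSwinnertonDyer.Theses.ClassRecordThree.EulerHalvesAtThree
  intro W _ _ hX
  refine ⟨fun hram _ ↦ ?_, fun hram _ _ _ ↦ ?_, fun hρ hnram ↦ ?_⟩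
  · exact missingUpperBoundAt_three_of_classX11b_of_ram_of_jetchevDivisibility hGZ hKo hSk hGZK hmod hnf
      hHL hMaz hrec hD36 hMcU hJ W hX hram
  · exact missingUpperBoundAt_three_of_classX11b_of_ram_of_jetchevDivisibility hGZ hKo hSk hGZK hmod hnf
      hHL hMaz hrec hD36 hMcU hJ W hX hram
  · by_cases hsplit : W.HasSplitMultiplicativeReductionAtPrime 3
    · exact missingUpperBoundAt_three_of_classX11b_of_split_of_surj_of_not_ram_of_jetchevDivisibility_of_twistLower
        hGZ hKo hGZK hmod hnf hHL hMaz hrec hD36 hMcU hJ0 hTL W hX hsplit hρ hnram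
    · exact missingUpperBoundAt_three_of_classX11b_of_not_split_of_surj_of_regulatorNonvanishing hK hJn
        hDn hHn hLns hGZK hpar W hX hsplit hρ (hRegNR W hX hnram hρ hsplit)

end Summit.BirchSwinnertonDyer.Rank1Residual.X11b.Three.Koly

end
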